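import Summits.BirchSwinnertonDyer.BirchSwinnertonDyer.Theorems.ResidualThetaTransportAtTwoResidualSignedLambdaLowerCMAtTwoDeepHalfAtTwoLevelwise
import Summits.BirchSwinnertonDyer.BirchSwinnertonDyer.Theorems.ResidualThetaTransportAtTwoResidualSignedLambdaLowerCMAtTwoCofreeSelmerTransferKummer
import Summits.BirchSwinnertonDyer.BirchSwinnertonDyer.Theorems.ResidualThetaTransportAtTwoResidualSignedLambdaLowerCMAtTwoCofreeSelmerTransfer
import Summits.BirchSwinnertonDyer.BirchSwinnertonDyer.Theorems.ThetaPartnerAtTwoSignedKatoUpToAtTwoPointsFunctional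
import HarnessLib

/-!
# Stub-ideation k = 1 (gen 16), technique «weaken / strengthen», on `stub_cmLambdaLower` = RSL_g (stmt-22608) of
# `Cruxes/ResidualThetaCountLowerPureAtTwo/Lines/bt26_lambda.lean` (crux (R≥)ᵖ, stmt-26074)

GLUE-67 CLOSED IN KERNEL, SIGN-FREE: the WEAKEST sufficient 2-adic input of the split stub S4₂ (`stub_deepHalfAtTwoStrict`) is the
VALUE-FORM orthogonality (HV) on Kummer data of classes of a test set `Rel ⊇ {unramified outside p·S₀ ∧ trivial at ∞}` — and from it the
STRONGEST form the deep half consumes, p694426's levelwise orthogonality `hT` for ALL layer tuples (`Pn = ⊤`), follows by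
(T)_ρ (`transferH1_mem_relaxed_of_shapiroLift`, p692705) + the EXACT transported Θ-Kummer datum at `σ = 1` (§2, from T3♮ §1 p693471) +
the `ℚ/ℤ → ℤ/p^k` faithfulness step (§1). §5 is the one-call levelwise S4₂: (HV) ⟹ `∃ c ∈ H¹(Γ_n, A_ρ[p^k])` [adm] ∧ [strict at S₀] ∧ [val on
all layer tuples] (= a point of `Sol n k` for p692412).  No sign, no `∀ σ` Kummer clause, no Coates–Greenberg, no B7: none is consumed.

BSD is NOT proved by any of this; RSL_g (22608), (R≥)ᵖ (26074) and S4₂ stay OPEN. `sorry`-free; theorems only.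
-/

set_option autoImplicit false
set_option linter.dupNamespace false

noncomputable section

open scoped Classical

namespace Summit.BirchSwinnertonDyer.BirchSwinnertonDyer.Cruxes.ResidualThetaCountLowerPureAtTwo.SideaK1G16

open CategoryTheory Field NumberField IsDedekindDomain WeierstrassCurve
  Literature.NumberTheory.EllipticCurves Literature.NumberTheory.EllipticCurves.CyclotomicLayer
  Literature.NumberTheory.EllipticCurves.Kobayashi2003 Literature.NumberTheory.EllipticCurves.Sprung2012
  Literature.NumberTheory.EllipticCurves.GreenbergSelmer Literature.NumberTheory.EllipticCurves.GreenbergVatsal2000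
  Literature.NumberTheory.GaloisRepresentations Literature.NumberTheory.GaloisRepresentations.DiscreteGaloisModule
  Literature.NumberTheory.GaloisCohomology ZpExtension
  Summit.BirchSwinnertonDyer.BirchSwinnertonDyer.Theorems
  Summit.BirchSwinnertonDyer.BirchSwinnertonDyer.Theorems.ThetaTransport.CofreeSelmerTransfer
  Summit.BirchSwinnertonDyer.BirchSwinnertonDyer.Theorems.ThetaTransport.DeepHalfLevelwise

/-! ## §1 H-A — faithfulness of the level value: `(x mod p^k)·p^{-k} = 0` in `ℚ/ℤ` forces `x mod p^k = 0` -/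

section Arith

variable (p : ℕ) [Fact p.Prime]

/-- **H-A.** If the level value `(x mod p^k) • (1/p^k) ∈ ℚ/ℤ` of `x ∈ ℤ_p` vanishes then `x ≡ 0 mod p^k`
(`1/p^k` has order `p^k` and `(x mod p^k).val < p^k`). [folklore] -/
theorem toZModPow_eq_zero_of_val_nsmul_invPow_eq_zero (k : ℕ) (x : ℤ_[p])
    (h : (PadicInt.toZModPow k x).val • ((((p : ℚ) ^ k)⁻¹ : ℚ) : AddCircle (1 : ℚ)) = 0) :
    PadicInt.toZModPow k x = 0 := by
  haveI : NeZero (p ^ k) := ⟨pow_ne_zero k (Fact.out : p.Prime).ne_zero⟩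
  have hd : p ^ k ∣ (PadicInt.toZModPow k x).val := SignedKatoOffTwo.KummerPoint.pow_dvd_of_nsmul_invPow_eq_zero p h
  exact (ZMod.val_eq_zero _).mp (Nat.eq_zero_of_dvd_of_lt hd (ZMod.val_lt _))

/-- The converse direction (trivial): `x ≡ 0 mod p^k ⟹` the level value vanishes — so (HV) below is EQUIVALENT to `hT`'s
`toZModPow … = 0` reading, i.e. nothing is lost in the weakening. [folklore] -/
theorem val_nsmul_invPow_eq_zero_of_toZModPow_eq_zero (k : ℕ) (x : ℤ_[p]) (h : PadicInt.toZModPow k x = 0) :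
    (PadicInt.toZModPow k x).val • ((((p : ℚ) ^ k)⁻¹ : ℚ) : AddCircle (1 : ℚ)) = 0 := by
  rw [h, ZMod.val_zero, zero_smul]

end Arith

/-! ## §2 H-V = Q87 (a) — the EXACT transported Θ-Kummer datum at `σ = 1` of the transferred class `τ_n c ∈ H¹(Γ_∞, A_ρ)` -/

section Transfer

variable {p : ℕ} [Fact p.Prime] (S : Set (PadicAlgCl p)) {d : ℕ} (ρ : FramedGaloisRep ℚ ↥(padicCoeffIntegers S) d)
  (k : ℕ) (W : WeierstrassCurve ℚ) [W.IsElliptic] {r : ℕ}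
  (Θ : Cofree ρ ↥(padicCoeffField S) ≃+ (Fin r → ↥(W.geomPrimaryTorsion p))) (κ : ZpExtension ℚ p)
  (v : HeightOneSpectrum (𝓞 ℚ))
  (hΘ : ∀ (δ : absoluteGaloisGroup (v.adicCompletion ℚ)) (m : Cofree ρ ↥(padicCoeffField S)) (i : Fin r),
    Θ (resGalOfEmb (closureEmb (K := ℚ) (v.adicCompletion ℚ)) δ • m) i =
      resGalOfEmb (closureEmb (K := ℚ) (v.adicCompletion ℚ)) δ • Θ m i)

set_option maxHeartbeats 1600000 in
include hΘ in
/-- **H-V (Q87 (a)): [kum] ⟹ the EXACT datum of the transferred class at `σ = 1`.** If `loc_n c = thetaLayerKummer Q₀` then the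
transferred class `τ_n c = res_{Γ_∞ ≤ Γ_n}((A_ρ[p^k] ↪ A_ρ)_* c) ∈ H¹(Γ_∞, A_ρ)` has a representative cocycle `φ` and ROOTS `R`
with `p^k • R i = Q₀ i` EXACTLY and the Θ-Kummer identity `ι(Θ(φ(res τ))_i) = τ R_i − R_i` for all `τ ∈ Gal(ℚ̄_v/ℚ_{∞,v})` — the
datum shape of clause (3) of RSL_g's counted set / of S2's (VAL) pin, with TOWER points `p^k • R i = Q₀ i ∈ E(ℚ_{n,v}) ≤ E(ℚ_{∞,v})`.
Proof: T3♮ §1 (`exists_thetaKummerWitness_of_layerLocOf_eq_thetaLayerKummer`) at level `n`, then restrict the cocycle along `Γ_∞ ≤ Γ_n`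
(no orbit argument, no conjugation: `σ = 1`). [cite: Kobayashi2003, §2 (p. 4), (8.23) (p. 18)] [cite: SerreGaloisCohomology1997, I §2.2–2.5] -/
theorem exists_exact_thetaKummerWitness_transferH1 (n : ℕ)
    (c : H1 (cofreeTorsionGaloisModule S ρ ((p ^ k : ℕ) : ℤ)) (κ.layerSubgroup n))
    (Q₀ : Fin r → ↥(localLayerPointsOfEmb κ (closureEmb (K := ℚ) (v.adicCompletion ℚ)) W n))
    (hkum : layerLocOf (cofreeTorsionGaloisModule S ρ ((p ^ k : ℕ) : ℤ)) κ v n c =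
      thetaLayerKummer S ρ k W Θ κ v hΘ n Q₀) :
    ∃ (φ : contOneCocycles (discreteTopRep κ.kerSubgroup (Cofree ρ ↥(padicCoeffField S))))
      (R : Fin r → localPoints W (v.adicCompletion ℚ)),
      oneCocycleClass (discreteTopRep κ.kerSubgroup (Cofree ρ ↥(padicCoeffField S))) φ =
        resOfLe (Cofree ρ ↥(padicCoeffField S)) (κ.kerSubgroup_le_layerSubgroup n)
          (pushH1 (κ.layerSubgroup n) (AddSubgroup.torsionBy (Cofree ρ ↥(padicCoeffField S)) ((p ^ k : ℕ) : ℤ)).subtype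
            (torsionBy_subtype_smul S ρ ((p ^ k : ℕ) : ℤ)) c) ∧
      (∀ i, (p ^ k) • R i = (Q₀ i : localPoints W (v.adicCompletion ℚ))) ∧
      ∀ (τ : localSubgroupOfEmb κ.kerSubgroup (closureEmb (K := ℚ) (v.adicCompletion ℚ))) (i : Fin r),
        pointsMapOfEmb W (closureEmb (K := ℚ) (v.adicCompletion ℚ))
            ((Θ (φ.1 (resGalSubgroupOfEmb κ.kerSubgroup (closureEmb (K := ℚ) (v.adicCompletion ℚ)) τ)) i :
              ↥(W.geomPrimaryTorsion p)) : W.geomPoints) =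
          (τ : absoluteGaloisGroup (v.adicCompletion ℚ)) • R i - R i := by
  obtain ⟨β, R, hβc, hR, hβ⟩ := exists_thetaKummerWitness_of_layerLocOf_eq_thetaLayerKummer S ρ k W Θ κ v hΘ n c Q₀ hkum
  refine ⟨contOneCocycles.pullback (subgroupInclusion (κ.kerSubgroup_le_layerSubgroup n))
      (resHomOfEquivariant (subgroupInclusion (κ.kerSubgroup_le_layerSubgroup n)) (AddMonoidHom.id (Cofree ρ ↥(padicCoeffField S)))
        (fun _ _ ↦ rfl))
      (contOneCocycles.pullback (ContinuousMonoidHom.id (κ.layerSubgroup n))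
        (resHomOfEquivariant (ContinuousMonoidHom.id (κ.layerSubgroup n))
          (AddSubgroup.torsionBy (Cofree ρ ↥(padicCoeffField S)) ((p ^ k : ℕ) : ℤ)).subtype (fun _ _ ↦ rfl)) β),
    R, ?_, hR, fun τ i ↦ ?_⟩
  · -- the class: `res ∘ push` of `[β] = c`
    rw [← hβc, resH1Hom_oneCocycleClass, ResidualLayer.resOfLe_oneCocycleClass]
  · -- the values on `Gal(ℚ̄_v/ℚ_{∞,v}) ≤ U_n`
    have hτn : (τ : absoluteGaloisGroup (v.adicCompletion ℚ)) ∈ layerGroup κ v n :=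
      κ.kerSubgroup_le_layerSubgroup n ((mem_localSubgroupOfEmb_iff κ.kerSubgroup (closureEmb (K := ℚ) (v.adicCompletion ℚ)) _).1 τ.2)
    have e2 : subgroupInclusion (κ.kerSubgroup_le_layerSubgroup n) (resGalSubgroupOfEmb κ.kerSubgroup (closureEmb (K := ℚ) (v.adicCompletion ℚ)) τ) =
        resGalSubgroupOfEmb (κ.layerSubgroup n) (closureEmb (K := ℚ) (v.adicCompletion ℚ)) ⟨(τ : absoluteGaloisGroup (v.adicCompletion ℚ)), hτn⟩ :=
      Subtype.ext rfl
    rw [contOneCocycles.pullback_apply, contOneCocycles.pullback_apply]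
    change pointsMapOfEmb W (closureEmb (K := ℚ) (v.adicCompletion ℚ)) ((Θ (((β.1
      (subgroupInclusion (κ.kerSubgroup_le_layerSubgroup n) (resGalSubgroupOfEmb κ.kerSubgroup (closureEmb (K := ℚ) (v.adicCompletion ℚ)) τ)) :
        ↥(AddSubgroup.torsionBy (Cofree ρ ↥(padicCoeffField S)) ((p ^ k : ℕ) : ℤ))) : Cofree ρ ↥(padicCoeffField S))) i :
        ↥(W.geomPrimaryTorsion p)) : W.geomPoints) = _
    rw [e2]
    exact hβ ⟨_, hτn⟩ i

include hΘ in
/-- **Corollary: the roots are TOWER data.** `p^k • R i = Q₀ i ∈ E(ℚ_{n,v}) ≤ E(ℚ_{∞,v})` — the hypothesis `hQ` of the (VAL)/(VAL-rel) pin.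
[cite: Kobayashi2003, (8.23) (p. 18)] -/
theorem exists_exact_thetaKummerWitness_transferH1_tower (n : ℕ)
    (c : H1 (cofreeTorsionGaloisModule S ρ ((p ^ k : ℕ) : ℤ)) (κ.layerSubgroup n))
    (Q₀ : Fin r → ↥(localLayerPointsOfEmb κ (closureEmb (K := ℚ) (v.adicCompletion ℚ)) W n))
    (hkum : layerLocOf (cofreeTorsionGaloisModule S ρ ((p ^ k : ℕ) : ℤ)) κ v n c =
      thetaLayerKummer S ρ k W Θ κ v hΘ n Q₀) :
    ∃ (φ : contOneCocycles (discreteTopRep κ.kerSubgroup (Cofree ρ ↥(padicCoeffField S))))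
      (R : Fin r → localPoints W (v.adicCompletion ℚ))
      (hQ : ∀ i, (p ^ k) • R i ∈ localTowerPointsOfEmb κ (closureEmb (K := ℚ) (v.adicCompletion ℚ)) W),
      oneCocycleClass (discreteTopRep κ.kerSubgroup (Cofree ρ ↥(padicCoeffField S))) φ =
        resOfLe (Cofree ρ ↥(padicCoeffField S)) (κ.kerSubgroup_le_layerSubgroup n)
          (pushH1 (κ.layerSubgroup n) (AddSubgroup.torsionBy (Cofree ρ ↥(padicCoeffField S)) ((p ^ k : ℕ) : ℤ)).subtype
            (torsionBy_subtype_smul S ρ ((p ^ k : ℕ) : ℤ)) c) ∧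
      (∀ (τ : localSubgroupOfEmb κ.kerSubgroup (closureEmb (K := ℚ) (v.adicCompletion ℚ))) (i : Fin r),
        pointsMapOfEmb W (closureEmb (K := ℚ) (v.adicCompletion ℚ))
            ((Θ (φ.1 (resGalSubgroupOfEmb κ.kerSubgroup (closureEmb (K := ℚ) (v.adicCompletion ℚ)) τ)) i :
              ↥(W.geomPrimaryTorsion p)) : W.geomPoints) =
          (τ : absoluteGaloisGroup (v.adicCompletion ℚ)) • R i - R i) ∧
      (fun i => (⟨(p ^ k) • R i, hQ i⟩ : ↥(localTowerPointsOfEmb κ (closureEmb (K := ℚ) (v.adicCompletion ℚ)) W))) =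
        fun i => ⟨(Q₀ i : localPoints W (v.adicCompletion ℚ)), localLayerPointsOfEmb_le_localTowerPointsOfEmb κ _ W n (Q₀ i).2⟩ := by
  obtain ⟨φ, R, hφ, hR, hK⟩ := exists_exact_thetaKummerWitness_transferH1 S ρ k W Θ κ v hΘ n c Q₀ hkum
  have hQ : ∀ i, (p ^ k) • R i ∈ localTowerPointsOfEmb κ (closureEmb (K := ℚ) (v.adicCompletion ℚ)) W := fun i => by
    rw [hR i]; exact localLayerPointsOfEmb_le_localTowerPointsOfEmb κ _ W n (Q₀ i).2
  exact ⟨φ, R, hQ, hφ, hK, funext fun i => Subtype.ext (hR i)⟩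

end Transfer

/-! ## §3–§5 GLUE-67 in kernel: (HV) on `Rel ⊇ {unr ∧ inf}` ⟹ p694426's levelwise orthogonality `hT` (all layer tuples) ⟹ S4₂ levelwise

(HV) = «VALUE-FORM ORTHOGONALITY»: for every `y ∈ Rel` and every TOWER Kummer datum `(φ, Q, k')` of `y` at `v`
(`[φ] = y`, `p^{k'} Q_i ∈ E(ℚ_{∞,v})`, `ι(Θ(φ(res τ))_i) = τ Q_i − Q_i` on `Gal(ℚ̄_v/ℚ_{∞,v})`) the level value
`(z(p^{k'} Q) mod p^{k'}) • p^{-k'} ∈ ℚ/ℤ` vanishes.  It is what «`c₂ z` vanishes on `SelRel`» ((H)) says once `c₂ z` is pinned by its values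
((VAL)/(VAL-rel), S2/U57) — §3 is that one-line conversion for a bare function `χ` — and it is the ONLY 2-adic input the deep half consumes. -/

section Glue

variable {p : ℕ} [Fact p.Prime] (S : Set (PadicAlgCl p)) {d : ℕ} (ρ : FramedGaloisRep ℚ ↥(padicCoeffIntegers S) d)
  (W : WeierstrassCurve ℚ) [W.IsElliptic] {r : ℕ} (k : ℕ)
  (ePk : ∀ k : ℕ, ↥(AddSubgroup.torsionBy (Cofree ρ ↥(padicCoeffField S)) ((p ^ k : ℕ) : ℤ)) →
    ↥(AddSubgroup.torsionBy (Cofree ρ ↥(padicCoeffField S)) ((p ^ k : ℕ) : ℤ)) → AlgebraicClosure ℚ)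
  (hμPk : ∀ k a b, ePk k a b ^ (p ^ k) = 1)
  (hadd₁Pk : ∀ k a₁ a₂ b, ePk k (a₁ + a₂) b = ePk k a₁ b * ePk k a₂ b)
  (hadd₂Pk : ∀ k a b₁ b₂, ePk k a (b₁ + b₂) = ePk k a b₁ * ePk k a b₂)
  (hgalPk : ∀ k (σ : absoluteGaloisGroup ℚ) (a b : ↥(AddSubgroup.torsionBy (Cofree ρ ↥(padicCoeffField S)) ((p ^ k : ℕ) : ℤ))),
    σ • ePk k a b = ePk k (cofreeTorsionGaloisModule S ρ _ σ a) (cofreeTorsionGaloisModule S ρ _ σ b))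
  (hnondeg : ∀ T, (∀ a, ePk k a T = 1) → T = 0)
  (Θ : Cofree ρ ↥(padicCoeffField S) ≃+ (Fin r → ↥(W.geomPrimaryTorsion p))) (κ : ZpExtension ℚ p)
  (v : HeightOneSpectrum (𝓞 ℚ))
  (hΘ : ∀ (δ : absoluteGaloisGroup (v.adicCompletion ℚ)) (m : Cofree ρ ↥(padicCoeffField S)) (i : Fin r),
    Θ (resGalOfEmb (closureEmb (K := ℚ) (v.adicCompletion ℚ)) δ • m) i =
      resGalOfEmb (closureEmb (K := ℚ) (v.adicCompletion ℚ)) δ • Θ m i)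
  (hκ : κ.IsCyclotomic) (hv : (p : 𝓞 ℚ) ∈ v.asIdeal)
  (S₀ : Finset (HeightOneSpectrum (𝓞 ℚ))) (hS₀ : ∀ w ∈ S₀, (p : 𝓞 ℚ) ∉ w.asIdeal)
  (hρ : ∀ w : HeightOneSpectrum (𝓞 ℚ), w ∉ S₀ → (p : 𝓞 ℚ) ∉ w.asIdeal → ρ.IsUnramifiedAt w)
  (n : ℕ) [Fintype (absoluteGaloisGroup ℚ ⧸ κ.layerSubgroup n)]
  {s : absoluteGaloisGroup ℚ ⧸ κ.layerSubgroup n → absoluteGaloisGroup ℚ}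
  (hs : ∀ x : absoluteGaloisGroup ℚ ⧸ κ.layerSubgroup n, (s x : absoluteGaloisGroup ℚ ⧸ κ.layerSubgroup n) = x)
  (hs1 : s ((1 : absoluteGaloisGroup ℚ) : absoluteGaloisGroup ℚ ⧸ κ.layerSubgroup n) = 1)
  (Rel : Set (subgroupH1 κ.kerSubgroup (Cofree ρ ↥(padicCoeffField S))))
  (z : (Fin r → localTowerPointsOfEmb κ (closureEmb (K := ℚ) (v.adicCompletion ℚ)) W) →+ ℤ_[p])

omit [W.IsElliptic] in
/-- **§3 (H) + (VAL-rel) ⟹ (HV).** If a function `χ` on `H¹(Γ_∞, A_ρ)` (the pairing character `c₂ z ∘ loc₂`, junk off `Rel`) takes on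
every `y ∈ Rel` the level value of every tower Kummer datum of `y` ((VAL-rel), the S2/U57 pin relativised to `Rel`) and vanishes on `Rel`
((H) of S4₂), then (HV) holds. One `Eq.trans`. [cite: Kobayashi2003, (8.23) (p. 18)] [cite: PerrinRiou1994Invent, §3.6.1] -/
theorem valueOrthogonal_of_valuePin (χ : subgroupH1 κ.kerSubgroup (Cofree ρ ↥(padicCoeffField S)) → AddCircle (1 : ℚ))
    (hval : ∀ y ∈ Rel, ∀ (φ : contOneCocycles (discreteTopRep κ.kerSubgroup (Cofree ρ ↥(padicCoeffField S))))
      (Q : Fin r → localPoints W (v.adicCompletion ℚ)) (k' : ℕ)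
      (hQ : ∀ i, (p ^ k') • Q i ∈ localTowerPointsOfEmb κ (closureEmb (K := ℚ) (v.adicCompletion ℚ)) W),
      oneCocycleClass (discreteTopRep κ.kerSubgroup (Cofree ρ ↥(padicCoeffField S))) φ = y →
      (∀ (τ : localSubgroupOfEmb κ.kerSubgroup (closureEmb (K := ℚ) (v.adicCompletion ℚ))) (i : Fin r),
        pointsMapOfEmb W (closureEmb (K := ℚ) (v.adicCompletion ℚ))
            ((Θ (φ.1 (resGalSubgroupOfEmb κ.kerSubgroup (closureEmb (K := ℚ) (v.adicCompletion ℚ)) τ)) i :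
              ↥(W.geomPrimaryTorsion p)) : W.geomPoints) =
          (τ : absoluteGaloisGroup (v.adicCompletion ℚ)) • Q i - Q i) →
      χ y = (PadicInt.toZModPow k' (z (fun i => ⟨(p ^ k') • Q i, hQ i⟩))).val • ((((p : ℚ) ^ k')⁻¹ : ℚ) : AddCircle (1 : ℚ)))
    (hH : ∀ y ∈ Rel, χ y = 0) :
    ∀ y ∈ Rel, ∀ (φ : contOneCocycles (discreteTopRep κ.kerSubgroup (Cofree ρ ↥(padicCoeffField S))))
      (Q : Fin r → localPoints W (v.adicCompletion ℚ)) (k' : ℕ)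
      (hQ : ∀ i, (p ^ k') • Q i ∈ localTowerPointsOfEmb κ (closureEmb (K := ℚ) (v.adicCompletion ℚ)) W),
      oneCocycleClass (discreteTopRep κ.kerSubgroup (Cofree ρ ↥(padicCoeffField S))) φ = y →
      (∀ (τ : localSubgroupOfEmb κ.kerSubgroup (closureEmb (K := ℚ) (v.adicCompletion ℚ))) (i : Fin r),
        pointsMapOfEmb W (closureEmb (K := ℚ) (v.adicCompletion ℚ))
            ((Θ (φ.1 (resGalSubgroupOfEmb κ.kerSubgroup (closureEmb (K := ℚ) (v.adicCompletion ℚ)) τ)) i :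
              ↥(W.geomPrimaryTorsion p)) : W.geomPoints) =
          (τ : absoluteGaloisGroup (v.adicCompletion ℚ)) • Q i - Q i) →
      (PadicInt.toZModPow k' (z (fun i => ⟨(p ^ k') • Q i, hQ i⟩))).val • ((((p : ℚ) ^ k')⁻¹ : ℚ) : AddCircle (1 : ℚ)) = 0 :=
  fun y hy φ Q k' hQ hφ hK => (hval y hy φ Q k' hQ hφ hK).symm.trans (hH y hy)

set_option maxHeartbeats 1600000 in
include hΘ hρ in
/-- **§4 GLUE-67: (HV) on `Rel ⊇ {unramified outside p·S₀ ∧ trivial at ∞}` ⟹ levelwise orthogonality `hT` for ALL layer tuples.**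
For `b ∈ H¹(Γ_n, A_ρ[p^k])` whose Shapiro lift is unramified outside `S₀ ∪ {p}` and trivial at `∞`, and a layer tuple `Q₀` with
`loc_n b = thetaLayerKummer Q₀`: (M) the transferred class `τ_n b` lies in the relaxed set (`transferH1_mem_relaxed_of_shapiroLift`, (T)_ρ) hence
in `Rel`; (V) it carries the EXACT tower datum `(φ, R, k)` with `p^k R = Q₀` (§2); (HV) kills the level value `(z Q₀ mod p^k) • p^{-k}`;
§1 turns that into `z Q₀ ≡ 0 mod p^k` — LITERALLY the `hT` binder of `DeepHalfLevelwise.exists_admissible_strict_valueCond_of_levelwise_orthogonal_top`.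
No sign hypothesis, no `∀ σ` clause, no Coates–Greenberg. CONDITIONAL on (HV); credit nothing.
[cite: Kobayashi2003, (8.23) (p. 18)] [cite: GreenbergVatsal2000, §2 pp. 16–17] [cite: NeukirchSchmidtWingberg2008, I §6 Prop. (1.6.4)]
[cite: PerrinRiou1994Invent, §3.6.1] -/
theorem levelwise_orthogonal_of_valueOrthogonal
    (hRel : ∀ y : subgroupH1 κ.kerSubgroup (Cofree ρ ↥(padicCoeffField S)),
      y ∈ unramifiedOutside κ.kerSubgroup (Cofree ρ ↥(padicCoeffField S)) p (↑S₀ : Set (HeightOneSpectrum (𝓞 ℚ))) →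
      (∀ (w : InfinitePlace ℚ) (σ : absoluteGaloisGroup ℚ), conjH1 κ.kerSubgroup (Cofree ρ ↥(padicCoeffField S)) σ y ∈
        infKer κ.kerSubgroup (Cofree ρ ↥(padicCoeffField S)) w) → y ∈ Rel)
    (hHV : ∀ y ∈ Rel, ∀ (φ : contOneCocycles (discreteTopRep κ.kerSubgroup (Cofree ρ ↥(padicCoeffField S))))
      (Q : Fin r → localPoints W (v.adicCompletion ℚ)) (k' : ℕ)
      (hQ : ∀ i, (p ^ k') • Q i ∈ localTowerPointsOfEmb κ (closureEmb (K := ℚ) (v.adicCompletion ℚ)) W),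
      oneCocycleClass (discreteTopRep κ.kerSubgroup (Cofree ρ ↥(padicCoeffField S))) φ = y →
      (∀ (τ : localSubgroupOfEmb κ.kerSubgroup (closureEmb (K := ℚ) (v.adicCompletion ℚ))) (i : Fin r),
        pointsMapOfEmb W (closureEmb (K := ℚ) (v.adicCompletion ℚ))
            ((Θ (φ.1 (resGalSubgroupOfEmb κ.kerSubgroup (closureEmb (K := ℚ) (v.adicCompletion ℚ)) τ)) i :
              ↥(W.geomPrimaryTorsion p)) : W.geomPoints) =
          (τ : absoluteGaloisGroup (v.adicCompletion ℚ)) • Q i - Q i) →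
      (PadicInt.toZModPow k' (z (fun i => ⟨(p ^ k') • Q i, hQ i⟩))).val • ((((p : ℚ) ^ k')⁻¹ : ℚ) : AddCircle (1 : ℚ)) = 0) :
    ∀ (b : H1 (cofreeTorsionGaloisModule S ρ ((p ^ k : ℕ) : ℤ)) (κ.layerSubgroup n))
      (Q₀ : Fin r → localLayerPointsOfEmb κ (closureEmb (K := ℚ) (v.adicCompletion ℚ)) W n),
      (∀ w : HeightOneSpectrum (𝓞 ℚ), w ∉ S₀ → (p : 𝓞 ℚ) ∉ w.asIdeal →
        galoisCohomology.localization
            ((cofreeTorsionGaloisModule S ρ ((p ^ k : ℕ) : ℤ)).coind (κ.layerSubgroup n) (κ.isOpen_layerSubgroup n)) (Sum.inr w) 1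
            (shapiroLift (cofreeTorsionGaloisModule S ρ ((p ^ k : ℕ) : ℤ)).toTopRep (κ.layerSubgroup n) (κ.isOpen_layerSubgroup n)
              hs hs1 b) ∈
          unramifiedSubgroup (GaloisRep.toLocal w
            ((cofreeTorsionGaloisModule S ρ ((p ^ k : ℕ) : ℤ)).coind (κ.layerSubgroup n) (κ.isOpen_layerSubgroup n))) 1) →
      (∀ w : InfinitePlace ℚ,
        galoisCohomology.localization
            ((cofreeTorsionGaloisModule S ρ ((p ^ k : ℕ) : ℤ)).coind (κ.layerSubgroup n) (κ.isOpen_layerSubgroup n)) (Sum.inl w) 1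
            (shapiroLift (cofreeTorsionGaloisModule S ρ ((p ^ k : ℕ) : ℤ)).toTopRep (κ.layerSubgroup n) (κ.isOpen_layerSubgroup n)
              hs hs1 b) = 0) →
      layerLocOf (cofreeTorsionGaloisModule S ρ ((p ^ k : ℕ) : ℤ)) κ v n b = thetaLayerKummer S ρ k W Θ κ v hΘ n Q₀ →
      PadicInt.toZModPow k (z (fun i => ⟨(Q₀ i : localPoints W (v.adicCompletion ℚ)),
        localLayerPointsOfEmb_le_localTowerPointsOfEmb κ _ W n (Q₀ i).2⟩)) = 0 := by
  intro b Q₀ hur hinf hkum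
  -- (M): the transferred class `τ_n b` is relaxed-Selmer ((T)_ρ, p692705), hence in `Rel`
  have hρ' : ∀ w : HeightOneSpectrum (𝓞 ℚ), w ∉ (↑S₀ : Set (HeightOneSpectrum (𝓞 ℚ))) → ((p : ℕ) : 𝓞 ℚ) ∉ w.asIdeal →
      ρ.IsUnramifiedAt w := fun w hw hp' => hρ w (fun h => hw (Finset.mem_coe.2 h)) hp'
  have hM := transferH1_mem_relaxed_of_shapiroLift S ρ κ ((p ^ k : ℕ) : ℤ) n hs hs1 hρ' b
    (fun w hw hp' => hur w (fun h => hw (Finset.mem_coe.2 h)) hp') hinf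
  have hy := hRel _ hM.1 hM.2
  -- (V): the EXACT tower datum of `τ_n b` at `σ = 1` (§2)
  obtain ⟨φ, R, hQ, hφ, hK, htuple⟩ := exists_exact_thetaKummerWitness_transferH1_tower S ρ k W Θ κ v hΘ n b Q₀ hkum
  -- (HV) in value form, then §1
  have h0 := hHV _ hy φ R k hQ hφ hK
  rw [htuple] at h0
  exact toZModPow_eq_zero_of_val_nsmul_invPow_eq_zero p k _ h0

include hnondeg hκ hv hS₀ hρ in
set_option maxHeartbeats 3200000 in
/-- **§5 S4₂ LEVELWISE IN ONE CALL: (HV) ⟹ a point of `Sol n k`.** (HV) on `Rel ⊇ {unr ∧ inf}` ⟹ some `c ∈ H¹(Γ_n, A_ρ[p^k])` is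
admissible outside `S₀ ∪ {w ∋ p}`, dies at every `w ∈ S₀`, and pairs with the Θ-Kummer class of EVERY layer-`n` tuple `Q` to `(z Q) mod p^k`
— §4 fed into `DeepHalfLevelwise.exists_admissible_strict_valueCond_of_levelwise_orthogonal_top` (p694426); this is the diagonal non-emptiness
`hne` (and the value condition `hSol`) of `DeepHalfTransfer.exists_iwasawaH1_locd₂_eq_of_levelwise_from` (p692412) at `(n, k)`.
CONDITIONAL on (HV); RSL_g / (R≥)ᵖ / S4₂ stay OPEN; BSD is not proved. [cite: MilneADT2006, Ch. I, Thm. 4.10(b)]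
[cite: Kobayashi2003, (7.17)–(7.21), (8.23)] [cite: Kato2004Asterisque, Lemma 8.5 (2) (p. 183)] -/
theorem exists_admissible_strict_valueCond_of_valueOrthogonal [CompactSpace (absoluteGaloisGroup ℚ)]
    [CompactSpace (absoluteGaloisGroup (v.adicCompletion ℚ))]
    (hRel : ∀ y : subgroupH1 κ.kerSubgroup (Cofree ρ ↥(padicCoeffField S)),
      y ∈ unramifiedOutside κ.kerSubgroup (Cofree ρ ↥(padicCoeffField S)) p (↑S₀ : Set (HeightOneSpectrum (𝓞 ℚ))) →
      (∀ (w : InfinitePlace ℚ) (σ : absoluteGaloisGroup ℚ), conjH1 κ.kerSubgroup (Cofree ρ ↥(padicCoeffField S)) σ y ∈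
        infKer κ.kerSubgroup (Cofree ρ ↥(padicCoeffField S)) w) → y ∈ Rel)
    (hHV : ∀ y ∈ Rel, ∀ (φ : contOneCocycles (discreteTopRep κ.kerSubgroup (Cofree ρ ↥(padicCoeffField S))))
      (Q : Fin r → localPoints W (v.adicCompletion ℚ)) (k' : ℕ)
      (hQ : ∀ i, (p ^ k') • Q i ∈ localTowerPointsOfEmb κ (closureEmb (K := ℚ) (v.adicCompletion ℚ)) W),
      oneCocycleClass (discreteTopRep κ.kerSubgroup (Cofree ρ ↥(padicCoeffField S))) φ = y →
      (∀ (τ : localSubgroupOfEmb κ.kerSubgroup (closureEmb (K := ℚ) (v.adicCompletion ℚ))) (i : Fin r),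
        pointsMapOfEmb W (closureEmb (K := ℚ) (v.adicCompletion ℚ))
            ((Θ (φ.1 (resGalSubgroupOfEmb κ.kerSubgroup (closureEmb (K := ℚ) (v.adicCompletion ℚ)) τ)) i :
              ↥(W.geomPrimaryTorsion p)) : W.geomPoints) =
          (τ : absoluteGaloisGroup (v.adicCompletion ℚ)) • Q i - Q i) →
      (PadicInt.toZModPow k' (z (fun i => ⟨(p ^ k') • Q i, hQ i⟩))).val • ((((p : ℚ) ^ k')⁻¹ : ℚ) : AddCircle (1 : ℚ)) = 0) :
    ∃ c : H1 (cofreeTorsionGaloisModule S ρ ((p ^ k : ℕ) : ℤ)) (κ.layerSubgroup n),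
      (∀ w : HeightOneSpectrum (𝓞 ℚ), w ∉ ((↑S₀ : Set (HeightOneSpectrum (𝓞 ℚ))) ∪ {u | (p : 𝓞 ℚ) ∈ u.asIdeal}) →
        ∀ 𝔓 ∈ w.primesAbove,
          resLe (cofreeTorsionGaloisModule S ρ ((p ^ k : ℕ) : ℤ)).toTopRep
            (inf_le_left : κ.layerSubgroup n ⊓ 𝔓.inertia (absoluteGaloisGroup ℚ) ≤ κ.layerSubgroup n) 1 c = 0) ∧
      (∀ w ∈ S₀,
        galoisCohomology.localization
            ((cofreeTorsionGaloisModule S ρ ((p ^ k : ℕ) : ℤ)).coind (κ.layerSubgroup n) (κ.isOpen_layerSubgroup n)) (Sum.inr w) 1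
            (shapiroLift (cofreeTorsionGaloisModule S ρ ((p ^ k : ℕ) : ℤ)).toTopRep (κ.layerSubgroup n) (κ.isOpen_layerSubgroup n)
              hs hs1 c) = 0) ∧
      ∀ (Q : Fin r → localPoints W (v.adicCompletion ℚ))
        (hQ : ∀ i, Q i ∈ localLayerPointsOfEmb κ (closureEmb (K := ℚ) (v.adicCompletion ℚ)) W n),
        layerPairingH1Of (cofreeTorsionGaloisModule S ρ ((p ^ k : ℕ) : ℤ)) (p ^ k) (ePk k) (hμPk k) (hadd₁Pk k) (hadd₂Pk k) (hgalPk k)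
            κ v n (layerLocOf (cofreeTorsionGaloisModule S ρ ((p ^ k : ℕ) : ℤ)) κ v n c)
            (thetaLayerKummer S ρ k W Θ κ v hΘ n (fun i => ⟨Q i, hQ i⟩)) =
          PadicInt.toZModPow k (z (fun i => ⟨Q i, localLayerPointsOfEmb_le_localTowerPointsOfEmb κ _ W n (hQ i)⟩)) :=
  exists_admissible_strict_valueCond_of_levelwise_orthogonal_top S ρ W k ePk hμPk hadd₁Pk hadd₂Pk hgalPk hnondeg Θ κ v hΘ hκ hv S₀ hS₀
    hρ n hs hs1 z (levelwise_orthogonal_of_valueOrthogonal S ρ W k Θ κ v hΘ S₀ hρ n hs hs1 Rel z hRel hHV)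

include hΘ hρ in
/-- **§5′ the literal `SelRel := {unr ∧ inf}` (Q88's first option): `hRel` is `fun _ h₁ h₂ ↦ ⟨h₁, h₂⟩`.** For the (C4) literal (an extra
local clause at `v ∣ p`) `hRel` is instead ONE inclusion `{unr ∧ inf} ⊆ SelRel` (Coates–Greenberg at good supersingular `p`, sidea k1-g14
`mem_selRel_of_unr_inf`) — the theorem above is literal-agnostic. [cite: GreenbergVatsal2000, §2] [cite: CoatesGreenberg1996, Prop. 4.7] -/
theorem levelwise_orthogonal_of_valueOrthogonal_unrInf
    (hHV : ∀ y ∈ {y : subgroupH1 κ.kerSubgroup (Cofree ρ ↥(padicCoeffField S)) |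
        y ∈ unramifiedOutside κ.kerSubgroup (Cofree ρ ↥(padicCoeffField S)) p (↑S₀ : Set (HeightOneSpectrum (𝓞 ℚ))) ∧
        ∀ (w : InfinitePlace ℚ) (σ : absoluteGaloisGroup ℚ), conjH1 κ.kerSubgroup (Cofree ρ ↥(padicCoeffField S)) σ y ∈
          infKer κ.kerSubgroup (Cofree ρ ↥(padicCoeffField S)) w},
      ∀ (φ : contOneCocycles (discreteTopRep κ.kerSubgroup (Cofree ρ ↥(padicCoeffField S))))
      (Q : Fin r → localPoints W (v.adicCompletion ℚ)) (k' : ℕ)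
      (hQ : ∀ i, (p ^ k') • Q i ∈ localTowerPointsOfEmb κ (closureEmb (K := ℚ) (v.adicCompletion ℚ)) W),
      oneCocycleClass (discreteTopRep κ.kerSubgroup (Cofree ρ ↥(padicCoeffField S))) φ = y →
      (∀ (τ : localSubgroupOfEmb κ.kerSubgroup (closureEmb (K := ℚ) (v.adicCompletion ℚ))) (i : Fin r),
        pointsMapOfEmb W (closureEmb (K := ℚ) (v.adicCompletion ℚ))
            ((Θ (φ.1 (resGalSubgroupOfEmb κ.kerSubgroup (closureEmb (K := ℚ) (v.adicCompletion ℚ)) τ)) i :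
              ↥(W.geomPrimaryTorsion p)) : W.geomPoints) =
          (τ : absoluteGaloisGroup (v.adicCompletion ℚ)) • Q i - Q i) →
      (PadicInt.toZModPow k' (z (fun i => ⟨(p ^ k') • Q i, hQ i⟩))).val • ((((p : ℚ) ^ k')⁻¹ : ℚ) : AddCircle (1 : ℚ)) = 0) :
    ∀ (b : H1 (cofreeTorsionGaloisModule S ρ ((p ^ k : ℕ) : ℤ)) (κ.layerSubgroup n))
      (Q₀ : Fin r → localLayerPointsOfEmb κ (closureEmb (K := ℚ) (v.adicCompletion ℚ)) W n),
      (∀ w : HeightOneSpectrum (𝓞 ℚ), w ∉ S₀ → (p : 𝓞 ℚ) ∉ w.asIdeal →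
        galoisCohomology.localization
            ((cofreeTorsionGaloisModule S ρ ((p ^ k : ℕ) : ℤ)).coind (κ.layerSubgroup n) (κ.isOpen_layerSubgroup n)) (Sum.inr w) 1
            (shapiroLift (cofreeTorsionGaloisModule S ρ ((p ^ k : ℕ) : ℤ)).toTopRep (κ.layerSubgroup n) (κ.isOpen_layerSubgroup n)
              hs hs1 b) ∈
          unramifiedSubgroup (GaloisRep.toLocal w
            ((cofreeTorsionGaloisModule S ρ ((p ^ k : ℕ) : ℤ)).coind (κ.layerSubgroup n) (κ.isOpen_layerSubgroup n))) 1) →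
      (∀ w : InfinitePlace ℚ,
        galoisCohomology.localization
            ((cofreeTorsionGaloisModule S ρ ((p ^ k : ℕ) : ℤ)).coind (κ.layerSubgroup n) (κ.isOpen_layerSubgroup n)) (Sum.inl w) 1
            (shapiroLift (cofreeTorsionGaloisModule S ρ ((p ^ k : ℕ) : ℤ)).toTopRep (κ.layerSubgroup n) (κ.isOpen_layerSubgroup n)
              hs hs1 b) = 0) →
      layerLocOf (cofreeTorsionGaloisModule S ρ ((p ^ k : ℕ) : ℤ)) κ v n b = thetaLayerKummer S ρ k W Θ κ v hΘ n Q₀ →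
      PadicInt.toZModPow k (z (fun i => ⟨(Q₀ i : localPoints W (v.adicCompletion ℚ)),
        localLayerPointsOfEmb_le_localTowerPointsOfEmb κ _ W n (Q₀ i).2⟩)) = 0 := by
  refine levelwise_orthogonal_of_valueOrthogonal S ρ W k Θ κ v hΘ S₀ hρ n hs hs1 _ z ?_ hHV
  exact fun _ h₁ h₂ => ⟨h₁, h₂⟩

end Glue

end Summit.BirchSwinnertonDyer.BirchSwinnertonDyer.Cruxes.ResidualThetaCountLowerPureAtTwo.SideaK1G16

end
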